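import Summits.PneNP.PneNP.Theorems.Sd2BlMachineGreedyFP
import Summits.PneNP.PneNP.Theorems.Sd2BlMachineRawLegsDict
import Summits.PneNP.PneNP.Theorems.Sd2BlMachineRows
import Summits.PneNP.PneNP.Theorems.Sd2BlNumerics

/-!
# Sign-degree-2 engine, the INSTANTIATED machine: coefficient tables, `ℓ(k)`, `t(k)`, the stretch `C(k)`
# (cell pnp-ideate, ROUND-18 item K1'' `SignDeg2Signing.SignDeg2SigningFP`, stage S3)

FRONTIER (range avoidance for sign-degree-≤2 local maps at linear stretch; restricted-model algorithmic
rung); nothing here bears on P vs NP.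

Fixing the parameters of the parametric machine `Sd2BlMachine.sd2Str k F0 F1 F2 ℓ t` (G5/G6) for the K1'' target:
* coefficient tables `F0k/F1k/F2k k` := the three components of prover-1's `rowTable₂ k` (the rows of the canonical
  certificate `certOfIntCert I le_rfl (fun j => certOf k 2 (I.table j) (h j))` — `SignDeg2Signing.canonCert I h` is
  this term by `rfl`), so that the table hypothesis `hF` of `Sd2BlMachineRawLegsDict.mem_rawLegs_iff` holds
  (`coef_canon_eq_coefF`, from `canonCert_c0/_c1/_c2`);
* legs per output `ellK k = max 3 (2·(uniformW k 2).toNat)` (`three_le_ellK`, and **`card_legs_out_le_ellK`** from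
  `SignDeg2Legs.card_legs_out_le_of_intCert`), size exponent `tK k = 32 + 8·ellK k` (so `(T1)` holds:
  `size_condition_tK`), stretch constant **`sd2C k = 48 · gRad (ellK k) (tK k)`**;
* the machine **`sd2StrK k := sd2Str k (F0k k) (F1k k) (F2k k) (ellK k) (tK k)`**, polynomial time
  (`isPolyTime_sd2StrK`), and `readOut_sd2StrK` (its answer on the code of `I` is the signing `sd2Bits` of the
  block-split certificate legs).
-/

set_option linter.dupNamespace false -- `Summit.PneNP.PneNP.…`: summit = sub-problem name (D-0017 single-conjunct layout)

namespace Summit.PneNP.PneNP.Theorems.Sd2BlMachine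

open Literature.Computability.Complexity
open Summit.PneNP.PneNP.Theorems.SfmBlMachine (PLeg)
open Summit.PneNP.PneNP.Theorems.SignRepCertificate (Cert)
open Summit.PneNP.PneNP.Theorems.SignDeg2Legs
open Summit.PneNP.PneNP.Theorems.SignDegCertBridge (certOf certOfIntCert uniformW uniformW_nonneg)
open Summit.PneNP.PneNP.Theorems.LocalMapDecodeFP (decode)

/-! ## The coefficient tables -/

/-- The constant-coefficient table. -/
noncomputable def F0k (k : ℕ) (P : (Fin k → Bool) → Bool) : ℤ := (rowTable₂ k P).1

/-- The linear-coefficient table. -/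
noncomputable def F1k (k : ℕ) (P : (Fin k → Bool) → Bool) (i : Fin k) : ℤ := (rowTable₂ k P).2.1 i

/-- The pair-coefficient table. -/
noncomputable def F2k (k : ℕ) (P : (Fin k → Bool) → Bool) (i i' : Fin k) : ℤ := (rowTable₂ k P).2.2 i i'

/-- **The table hypothesis `hF` for the canonical certificate**: every coefficient of
`certOfIntCert I le_rfl (fun j => certOf k 2 (I.table j) (h j))` is read off `I.table j` by the tables. -/
theorem coef_canon_eq_coefF {k n m : ℕ} (I : LocalMap k n m) (h : ∀ j, SignDegLE 2 (I.table j)) (j : Fin m)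
    (κ : Kind k) :
    coef (certOfIntCert I le_rfl fun j => certOf k 2 (I.table j) (h j)) j κ = coefF k (F0k k) (F1k k) (F2k k) (I.table j) κ := by
  rcases κ with _ | i | ⟨i, i'⟩
  · exact canonCert_c0 I h j
  · exact canonCert_c1 I h j i
  · exact canonCert_c2 I h j i i'

/-! ## Legs per output, size exponent, stretch -/

/-- Legs per output `ℓ(k) = max 3 (2·W)`, `W = uniformW k 2`. -/
noncomputable def ellK (k : ℕ) : ℕ := max 3 (2 * (uniformW k 2).toNat)

/-- `3 ≤ ℓ(k)`. -/
theorem three_le_ellK (k : ℕ) : 3 ≤ ellK k := le_max_left _ _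

/-- **Every output of the canonical certificate owns at most `ℓ(k)` legs.** -/
theorem card_legs_out_le_ellK {k n m : ℕ} (I : LocalMap k n m) (h : ∀ j, SignDegLE 2 (I.table j)) (j : Fin m) :
    (Finset.univ.filter fun e : CLeg (certOfIntCert I le_rfl fun j => certOf k 2 (I.table j) (h j)) => e.out = j).card
      ≤ ellK k := by
  have h1 := card_legs_out_le_of_intCert I le_rfl (fun j => certOf k 2 (I.table j) (h j)) j
  have hW : ((uniformW k 2).toNat : ℤ) = uniformW k 2 := Int.toNat_of_nonneg (uniformW_nonneg k 2)
  have h2 : ((Finset.univ.filter fun e : CLeg (certOfIntCert I le_rfl fun j => certOf k 2 (I.table j) (h j)) =>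
      e.out = j).card : ℤ) ≤ ((2 * (uniformW k 2).toNat : ℕ) : ℤ) := by
    push_cast; rw [hW]; exact h1
  exact le_trans (by exact_mod_cast h2) (le_max_right _ _)

/-- Size exponent `t(k) = 32 + 8·ℓ(k)`. -/
noncomputable def tK (k : ℕ) : ℕ := 32 + 8 * ellK k

/-- `1 ≤ t(k)`. -/
theorem one_le_tK (k : ℕ) : 1 ≤ tK k := by unfold tK; omega

/-- `(T1)` for `t(k)`. -/
theorem size_condition_tK (k : ℕ) :
    28800 * ellK k ^ 3 * (2 * tK k) * (2 * tK k + 1) ≤ 2 ^ tK k :=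
  Sd2Bl.size_condition_T1 (ellK k)

/-- **THE STRETCH CONSTANT** `C(k) = 48 · R(ℓ(k), t(k))`. -/
noncomputable def sd2C (k : ℕ) : ℕ := 48 * gRad (ellK k) (tK k)

/-- The stretch hypothesis in the pipeline's spelling. -/
theorem stretch_of_sd2C {k n m : ℕ} (hm : sd2C k * n ≤ m) :
    48 * (2400 * ellK k ^ 2 * (2 * tK k) * (2 * tK k + 1) * 2 ^ tK k) * n ≤ m := hm

/-- `0 < m` under the stretch (for `hBm : m < 2m`). -/
theorem pos_of_stretch {k n m : ℕ} (hn : 0 < n) (hm : sd2C k * n ≤ m) : 0 < m := by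
  have : 0 < sd2C k := by
    unfold sd2C gRad
    have := one_le_tK k
    have : 0 < ellK k := lt_of_lt_of_le (by norm_num) (three_le_ellK k)
    positivity
  exact lt_of_lt_of_le (Nat.mul_pos this hn) hm

/-! ## The instantiated machine -/

/-- **THE K1'' MACHINE** for locality `k`. -/
noncomputable def sd2StrK (k : ℕ) : List Bool → List Bool := sd2Str k (F0k k) (F1k k) (F2k k) (ellK k) (tK k)

/-- It is polynomial time. -/
theorem isPolyTime_sd2StrK (k : ℕ) : IsPolyTime (sd2StrK k) := isPolyTime_sd2Str (ellK k) (tK k) k (F0k k) (F1k k) (F2k k)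

/-- The raw legs of the code of `I` for the canonical tables. -/
noncomputable def rawK {k n m : ℕ} (I : LocalMap k n m) : List RLeg := rawLegs k (F0k k) (F1k k) (F2k k) (decode k I.encode)

/-- The pieced legs of the code of `I` (block length `L = 4^t(k)`). -/
noncomputable def plegsK {k n m : ℕ} (I : LocalMap k n m) : List PLeg := pieceLegsG (gL (tK k)) (rawK I)

/-- **On the code of `I` the machine signs the block-split certificate legs.** -/
theorem sd2StrK_encode {k n m : ℕ} (I : LocalMap k n m) :
    sd2StrK k I.encode = sd2Bits (ellK k) (tK k) m (plegsK I) :=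
  sd2Str_encode k (F0k k) (F1k k) (F2k k) (ellK k) (tK k) I

/-- The answer read off the machine's output is `readOut m (greedyBitsP (gPot …) m)`. -/
theorem readOut_sd2StrK {k n m : ℕ} (I : LocalMap k n m) :
    readOut m (sd2StrK k I.encode) = readOut m (greedyBitsP (gPot (ellK k) (tK k) m (plegsK I)) m) := by
  rw [sd2StrK_encode]; rfl

end Summit.PneNP.PneNP.Theorems.Sd2BlMachine
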